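import Mathlib.MeasureTheory.Measure.Haar.Disintegration
import Mathlib.Analysis.Calculus.Deriv.Inverse
import Mathlib.Topology.Order.LeftRightNhds
import Literature.Geometry.Lorentzian.InverseMeanCurvatureFlowLipschitz
import HarnessLib

/-!
# Inverse mean curvature flow I — proofs: a.e. calculus of locally Lipschitz level-set functions

Sorry-free continuation of `InverseMeanCurvatureFlowLipschitz.lean` (Huisken–Ilmanen,
J. Differential Geom. 59 (2001), §1): the almost-everywhere calculus of `max`, `min`, positive
parts, translates and multiples of locally Lipschitz functions on a Riemannian `3`-manifold `X`,
with respect to the Riemannian measure `μ_h`. These are the pointwise facts behind every energy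
comparison of §§1–2 ("inserting `min(v, u)`", "`|∇u| = 0` a.e. on `{u = t}`", …). Everything is
proved; there are no definitions and no named facts.

* `ae_imp_of_forall_exists_nhdsWithin` — a.e. statements on a measurable `Ω` are local (second
  countability).
* **The derivative vanishes a.e. on level sets.** Euclidean form
  (`volume_setOf_eq_zero_and_fderiv_ne_zero`): for continuous `F : ℝ³ → ℝ` the set
  `{F = 0, F differentiable, DF ≠ 0}` is Lebesgue-null — along each coordinate line its points are
  zeros with nonzero derivative, which are isolated (`Real.countable_setOf_eq_zero_of_deriv_ne_zero`,
  via Mathlib's `HasDerivAt.eventually_ne` and `countable_setOf_isolated_right_within`), and a set with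
  null line sections is null (disintegration of Lebesgue measure along lines, Mathlib's
  `ae_mem_of_ae_add_linearMap_mem`). Manifold form
  (`IsLocLipschitzOn.ae_mfderiv_eq_zero_of_eq_zero`, `.ae_mfderiv_eq_of_eq`, `.ae_gradNorm_eq_of_eq`,
  `.ae_gradNorm_eq_zero_of_eq_const`): for `u, v` locally Lipschitz on an open `Ω`, `du = dv` and
  `|∇u| = |∇v|` at `μ_h`-a.e. point of `Ω ∩ {u = v}`; in particular `|∇u| = 0` a.e. on `{u = t}`
  (Huisken–Ilmanen, proof of Lemma 1.4 (ii)).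
* **Lipschitz algebra** (`IsLocLipschitzOn.add/sub/neg/add_const/const_mul/sup/inf/posPart`).
* **Pointwise slope identities** (`gradNorm_add_const`, `gradNorm_sub_const`, `gradNorm_const_mul`,
  `gradNorm_neg`, `gradNorm_sub_comm` — everywhere, via the chart formula `gradNorm_sq_eq_sum_chart`
  and the unconditional rules `fderiv_add_const`, `fderiv_const_smul_field`; `gradNorm_sup_of_lt/gt`,
  `gradNorm_inf_of_lt/gt`, `gradNorm_posPart_of_pos/neg` — at strict points, by locality;
  `gradNorm_add_le` — the triangle inequality `|∇(u+v)| ≤ |∇u| + |∇v|` where both are differentiable,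
  since `|∇u|(x) = ‖♯du_x‖_x`).
* **A.e. packages** (`IsLocLipschitzOn.ae_gradNorm_sup_of_le/ge`, `.ae_gradNorm_inf_of_le/ge`,
  `.ae_gradNorm_posPart_of_nonneg/nonpos`, `.ae_gradNorm_sup_add_gradNorm_inf`): a.e. on `Ω`,
  `|∇max(u,v)|` is `|∇u|` on `{v ≤ u}` and `|∇v|` on `{u ≤ v}`, etc., and
  `|∇max(u,v)| + |∇min(u,v)| = |∇u| + |∇v|` (the pointwise content of Huisken–Ilmanen's identity
  `J_u(min(v,w)) + J_u(max(v,w)) = J_u(v) + J_u(w)`, §1 after (1.5)).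

## References

* G. Huisken, T. Ilmanen, *The inverse mean curvature flow and the Riemannian Penrose
  inequality*, J. Differential Geom. 59 (2001) 353–437: §1 (identity after (1.5); proof of
  Lemma 1.4 (ii): `|∇u| = 0` a.e. on `{u = t}`).
* H. Federer, *Geometric Measure Theory*, Springer 1969, 3.1.6 (Rademacher), 2.10.11.
* L. C. Evans, R. F. Gariepy, *Measure theory and fine properties of functions*, CRC 1992, §4.2.2,
  Thm. 4 (iv) (`Du = 0` a.e. on `{u = 0}` for Sobolev/Lipschitz `u`) — the classical statement of the
  level-set lemma proved here from first principles.
-/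

noncomputable section

open Bundle Set Manifold TopologicalSpace Filter MeasureTheory Function
open scoped ContDiff Topology ENNReal NNReal Manifold Real

namespace Literature.Geometry.Lorentzian

open PseudoRiemannianMetric

/-! ### Local-to-global for almost-everywhere statements -/

section LocalToGlobal

variable {X : Type*} [TopologicalSpace X] [SecondCountableTopology X] [MeasurableSpace X]

/-- **A.e. statements are local.** If every point of a measurable set `Ω` has a neighbourhood
within `Ω` on which `P` holds almost everywhere, then `P` holds at almost every point of `Ω`
(second countability: countably many such neighbourhoods cover `Ω`). [folklore] -/
theorem ae_imp_of_forall_exists_nhdsWithin {μ : Measure X} {Ω : Set X} (hΩ : MeasurableSet Ω)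
    {P : X → Prop} (hloc : ∀ p ∈ Ω, ∃ U ∈ 𝓝[Ω] p, ∀ᵐ q ∂μ.restrict U, P q) :
    ∀ᵐ q ∂μ, q ∈ Ω → P q := by
  choose! U hU hUae using hloc
  obtain ⟨T, hTΩ, hTc, hcover⟩ := TopologicalSpace.countable_cover_nhdsWithin hU
  have h1 : ∀ᵐ q ∂μ.restrict (⋃ x ∈ T, U x), P q :=
    (ae_restrict_biUnion_iff U hTc _).2 fun x hx ↦ hUae x (hTΩ hx)
  exact (ae_restrict_iff' hΩ).1 (ae_restrict_of_ae_restrict_of_subset hcover h1)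

end LocalToGlobal

/-! ### The derivative vanishes a.e. on a level set: the Euclidean statement -/

section Euclidean

/-- **Zeros with nonzero derivative are isolated, hence countable**: for any `g : ℝ → ℝ`, the set
of `t` with `g t = 0`, `g` differentiable at `t` and `g'(t) ≠ 0` is countable (each such `t` is
isolated in the set, `HasDerivAt.eventually_ne`, and a set of right-isolated points of `ℝ` is
countable, `countable_setOf_isolated_right_within`). [folklore] -/
theorem Real.countable_setOf_eq_zero_of_deriv_ne_zero (g : ℝ → ℝ) :
    {t : ℝ | g t = 0 ∧ DifferentiableAt ℝ g t ∧ deriv g t ≠ 0}.Countable := by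
  set S := {t : ℝ | g t = 0 ∧ DifferentiableAt ℝ g t ∧ deriv g t ≠ 0} with hS
  have hiso : ∀ x ∈ S, 𝓝[S ∩ Ioi x] x = ⊥ := by
    rintro x ⟨hx0, hxd, hxne⟩
    have h1 : ∀ᶠ z in 𝓝[≠] x, g z ≠ 0 := hxd.hasDerivAt.eventually_ne hxne
    have h2 : ∀ᶠ z in 𝓝[S ∩ Ioi x] x, g z ≠ 0 :=
      h1.filter_mono (nhdsWithin_mono _ fun z hz ↦ ne_of_gt hz.2)
    have h3 : ∀ᶠ z in 𝓝[S ∩ Ioi x] x, g z = 0 :=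
      eventually_nhdsWithin_of_forall fun z hz ↦ hz.1.1
    exact Filter.eventually_false_iff_eq_bot.1 ((h2.and h3).mono fun z hz ↦ hz.1 hz.2)
  have heq : S = {x ∈ S | 𝓝[S ∩ Ioi x] x = ⊥} :=
    Set.ext fun x ↦ ⟨fun hx ↦ ⟨hx, hiso x hx⟩, fun hx ↦ hx.1⟩
  rw [heq]
  exact countable_setOf_isolated_right_within

/-- A continuous linear functional on `ℝ³` vanishing on the standard basis vanishes. [folklore] -/
theorem eq_zero_of_forall_apply_basisFun_eq_zero {L : E3 →L[ℝ] ℝ}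
    (hL : ∀ i, L (EuclideanSpace.basisFun (Fin 3) ℝ i) = 0) : L = 0 := by
  apply ContinuousLinearMap.coe_injective
  refine (EuclideanSpace.basisFun (Fin 3) ℝ).toBasis.ext fun i ↦ ?_
  simpa using hL i

/-- The exceptional set of `volume_setOf_eq_zero_and_fderiv_ne_zero` is measurable (for continuous
`F`; the differentiability set and `fderiv` of any function are Borel). [folklore] -/
theorem measurableSet_setOf_eq_zero_and_fderiv_ne_zero {F : E3 → ℝ} (hF : Continuous F) :
    MeasurableSet {y : E3 | F y = 0 ∧ DifferentiableAt ℝ F y ∧ fderiv ℝ F y ≠ 0} := by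
  rw [setOf_and, setOf_and]
  exact (hF.measurable (measurableSet_singleton 0)).inter
    ((measurableSet_of_differentiableAt ℝ F).inter
      ((measurable_fderiv ℝ F) (measurableSet_singleton 0).compl))

/-- **On the zero set of a function the derivative vanishes almost everywhere** (Euclidean form):
for a continuous `F : ℝ³ → ℝ` the set of points `y` with `F y = 0`, `F` differentiable at `y` and
`DF(y) ≠ 0` is Lebesgue-null. Proof: if `DF(y) ≠ 0` then some partial derivative `∂ᵢF(y) ≠ 0`; along
every line in the direction `eᵢ` such points are zeros of `t ↦ F(y + t eᵢ)` with nonzero derivative,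
hence countable (`Real.countable_setOf_eq_zero_of_deriv_ne_zero`), and a set all of whose line
sections are null is null (disintegration of Haar measure along lines, Mathlib's
`ae_mem_of_ae_add_linearMap_mem`). This is the standard lemma `∇u = 0` a.e. on `{u = t}` behind
Huisken–Ilmanen's "`|∇u| = 0` a.e. on `{u = t}`" (§1, proof of Lemma 1.4 (ii)). [cite: HuiskenIlmanenIMCF2001, §1 proof of Lemma 1.4 (ii)] -/
theorem volume_setOf_eq_zero_and_fderiv_ne_zero {F : E3 → ℝ} (hF : Continuous F) :
    volume {y : E3 | F y = 0 ∧ DifferentiableAt ℝ F y ∧ fderiv ℝ F y ≠ 0} = 0 := by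
  set b := EuclideanSpace.basisFun (Fin 3) ℝ with hb
  -- reduce to a fixed coordinate direction
  have hsub : {y : E3 | F y = 0 ∧ DifferentiableAt ℝ F y ∧ fderiv ℝ F y ≠ 0} ⊆
      ⋃ i, {y : E3 | F y = 0 ∧ DifferentiableAt ℝ F y ∧ fderiv ℝ F y (b i) ≠ 0} := by
    rintro y ⟨h0, hd, hne⟩
    by_contra hcon
    simp only [mem_iUnion, mem_setOf_eq, not_exists, not_and, not_not] at hcon
    exact hne (eq_zero_of_forall_apply_basisFun_eq_zero fun i ↦ hcon i h0 hd)
  refine measure_mono_null hsub (measure_iUnion_null fun i ↦ ?_)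
  set A := {y : E3 | F y = 0 ∧ DifferentiableAt ℝ F y ∧ fderiv ℝ F y (b i) ≠ 0} with hA
  have hAm : MeasurableSet A := by
    rw [hA, setOf_and, setOf_and]
    exact (hF.measurable (measurableSet_singleton 0)).inter
      ((measurableSet_of_differentiableAt ℝ F).inter
        ((measurable_fderiv_apply_const ℝ F (b i)) (measurableSet_singleton 0).compl))
  -- it suffices that a.e. point lies off `A`, which is checked along the lines `y + t bᵢ`
  rw [← compl_mem_ae_iff]
  refine ae_mem_of_ae_add_linearMap_mem (LinearMap.toSpanSingleton ℝ E3 (b i))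
    (volume : Measure ℝ) (volume : Measure E3) hAm.compl fun y ↦ ?_
  have hcount : {t : ℝ | y + t • b i ∈ A}.Countable := by
    refine (Real.countable_setOf_eq_zero_of_deriv_ne_zero (fun t ↦ F (y + t • b i))).mono ?_
    rintro t ⟨h0, hd, hne⟩
    have hl : HasDerivAt (fun t : ℝ ↦ y + t • b i) (b i) t := by
      simpa using ((hasDerivAt_id t).smul_const (b i)).const_add y
    have hg : HasDerivAt (fun t ↦ F (y + t • b i)) (fderiv ℝ F (y + t • b i) (b i)) t :=
      hd.hasFDerivAt.comp_hasDerivAt t hl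
    exact ⟨h0, hg.differentiableAt, by rwa [hg.deriv]⟩
  have hnull : volume {t : ℝ | y + t • b i ∈ A} = 0 := hcount.measure_zero volume
  rw [ae_iff]
  refine measure_mono_null (fun t ht ↦ ?_) hnull
  change ¬ (y + (LinearMap.toSpanSingleton ℝ E3 (b i)) t ∈ Aᶜ) at ht
  rw [LinearMap.toSpanSingleton_apply] at ht
  exact not_not.1 ht

end Euclidean

variable {X : Type*} [TopologicalSpace X] [ChartedSpace E3 X] [IsManifold (𝓡 3) ∞ X]

/-! ### The derivative vanishes a.e. on a level set: locally Lipschitz functions on `X` -/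

section LevelSet

variable (h : ContMDiffRiemannianMetric (𝓡 3) ∞ E3 (TangentSpace (𝓡 3) : X → Type _))

/-- If the chart representative `u ∘ φ⁻¹` has vanishing Fréchet derivative at `φ p` then
`du_p = 0` (the coordinate vectors `∂ᵢ|_p` form a basis of `T_p X` and `du_p(∂ᵢ) = ∂ᵢ(u ∘ φ⁻¹)(φ p)`,
`mfderiv_apply_localFrame`). [folklore] -/
theorem mfderiv_eq_zero_of_fderiv_chart_eq_zero {u : X → ℝ} {x₀ p : X}
    (hp : p ∈ (chartAt E3 x₀).source)
    (h0 : fderiv ℝ (u ∘ (extChartAt (𝓡 3) x₀).symm) (extChartAt (𝓡 3) x₀ p) = 0) :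
    mfderiv (𝓡 3) 𝓘(ℝ, ℝ) u p = 0 := by
  classical
  set b : Module.Basis (Fin 3) ℝ E3 := (EuclideanSpace.basisFun (Fin 3) ℝ).toBasis with hb
  have hpe : p ∈ (trivializationAt E3 (TangentSpace (𝓡 3)) x₀).baseSet := by
    rwa [TangentBundle.trivializationAt_baseSet]
  apply ContinuousLinearMap.coe_injective
  refine ((trivializationAt E3 (TangentSpace (𝓡 3)) x₀).basisAt b hpe).ext fun i ↦ ?_
  have hi : (trivializationAt E3 (TangentSpace (𝓡 3)) x₀).basisAt b hpe i =
      (trivializationAt E3 (TangentSpace (𝓡 3)) x₀).localFrame b i p :=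
    (Trivialization.localFrame_apply_of_mem_baseSet _ b hpe).symm
  rw [hi, ContinuousLinearMap.coe_coe, mfderiv_apply_localFrame b hp i, h0]
  rfl

variable [T2Space X] [LocallyCompactSpace X] [MeasurableSpace X] [BorelSpace X]
  [SecondCountableTopology X]

/-- **The differential of a locally Lipschitz function vanishes a.e. on its zero set.** If `f` is
locally Lipschitz (for the Riemannian distance) on the open set `Ω`, then for `μ_h`-a.e. `p ∈ Ω`
with `f p = 0` one has `df_p = 0`. In a chart neighbourhood, `f ∘ φ⁻¹` is Lipschitz and extends to
a Lipschitz `F` on `ℝ³` (McShane); the exceptional set is contained in the `φ`-preimage of the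
Lebesgue-null set of `volume_setOf_eq_zero_and_fderiv_ne_zero`, which is `μ_h`-null
(`riemannianMeasure_source_inter_preimage_eq_zero`). Huisken–Ilmanen 2001, §1 ("`|∇u| = 0`
a.e. on `{u = t}`", proof of Lemma 1.4 (ii)). [cite: HuiskenIlmanenIMCF2001, §1 proof of Lemma 1.4 (ii)] -/
theorem IsLocLipschitzOn.ae_mfderiv_eq_zero_of_eq_zero {f : X → ℝ} {Ω : Set X}
    (hf : IsLocLipschitzOn h f Ω) (hΩ : IsOpen Ω) :
    ∀ᵐ p ∂(riemannianMeasure h), p ∈ Ω → f p = 0 → mfderiv (𝓡 3) 𝓘(ℝ, ℝ) f p = 0 := by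
  -- the exceptional set is locally null
  have hN : ∀ᵐ p ∂(riemannianMeasure h), p ∈ Ω →
      ¬ (f p = 0 ∧ MDifferentiableAt (𝓡 3) 𝓘(ℝ, ℝ) f p ∧ mfderiv (𝓡 3) 𝓘(ℝ, ℝ) f p ≠ 0) := by
    refine ae_imp_of_forall_exists_nhdsWithin hΩ.measurableSet fun p hp ↦ ?_
    obtain ⟨U, hUo, hpU, -, hUs, K, hK⟩ := hf.exists_lipschitzOnWith_chart h hΩ hp
    refine ⟨U, mem_nhdsWithin_of_mem_nhds (hUo.mem_nhds hpU), ?_⟩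
    -- the chart image of `U` is open; extend `f ∘ φ⁻¹` from it to a Lipschitz `F` on `ℝ³`
    have hS : IsOpen (extChartAt (𝓡 3) p '' U) := by
      rw [(extChartAt (𝓡 3) p).image_eq_target_inter_inv_preimage hUs]
      exact (continuousOn_extChartAt_symm p).isOpen_inter_preimage (isOpen_extChartAt_target p) hUo
    obtain ⟨F, hF, hFeq⟩ := hK.extend_real
    have hnull := riemannianMeasure_source_inter_preimage_eq_zero h p
      (measurableSet_setOf_eq_zero_and_fderiv_ne_zero hF.continuous)
      (volume_setOf_eq_zero_and_fderiv_ne_zero hF.continuous)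
    rw [ae_restrict_iff' hUo.measurableSet, ae_iff]
    refine measure_mono_null (fun q hq ↦ ?_) hnull
    simp only [Classical.not_imp, not_not, mem_setOf_eq] at hq
    obtain ⟨hqU, hq0, hqd, hqne⟩ := hq
    have hqs : q ∈ (chartAt E3 p).source := by rw [← extChartAt_source (𝓡 3)]; exact hUs hqU
    -- near `φ q`, `F` agrees with `f ∘ φ⁻¹`
    have hgerm : F =ᶠ[𝓝 (extChartAt (𝓡 3) p q)] f ∘ (extChartAt (𝓡 3) p).symm :=
      Filter.eventuallyEq_of_mem (hS.mem_nhds (mem_image_of_mem _ hqU)) fun y hy ↦ (hFeq hy).symm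
    refine ⟨hUs hqU, ?_⟩
    simp only [mem_preimage, mem_setOf_eq]
    refine ⟨?_, ?_, ?_⟩
    · rw [hgerm.eq_of_nhds, Function.comp_apply, (extChartAt (𝓡 3) p).left_inv (hUs hqU)]
      exact hq0
    · exact (hgerm.differentiableAt_iff).2 ((mdifferentiableAt_iff_differentiableAt_chart hqs).1 hqd)
    · rw [hgerm.fderiv_eq]
      exact fun h0 ↦ hqne (mfderiv_eq_zero_of_fderiv_chart_eq_zero hqs h0)
  filter_upwards [hN, hf.ae_mdifferentiableAt h hΩ] with p hp hpd hpΩ hp0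
  by_contra hne
  exact hp hpΩ ⟨hp0, hpd hpΩ, hne⟩

end LevelSet

/-! ### Algebra of locally Lipschitz functions -/

section LipschitzAlgebra

/-- `max` of two locally Lipschitz real functions is locally Lipschitz (on a set, in any
pseudo-emetric space). [folklore] -/
theorem _root_.LocallyLipschitzOn.max_real {α : Type*} [PseudoEMetricSpace α] {f g : α → ℝ}
    {s : Set α} (hf : LocallyLipschitzOn s f) (hg : LocallyLipschitzOn s g) :
    LocallyLipschitzOn s fun x ↦ max (f x) (g x) := by
  intro x hx
  obtain ⟨Kf, t, ht, hKf⟩ := hf hx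
  obtain ⟨Kg, t', ht', hKg⟩ := hg hx
  refine ⟨max Kf Kg, t ∩ t', inter_mem ht ht', ?_⟩
  have h1 : LipschitzWith Kf ((t ∩ t').restrict f) :=
    lipschitzOnWith_iff_restrict.1 (hKf.mono Set.inter_subset_left)
  have h2 : LipschitzWith Kg ((t ∩ t').restrict g) :=
    lipschitzOnWith_iff_restrict.1 (hKg.mono Set.inter_subset_right)
  exact lipschitzOnWith_iff_restrict.2 (h1.max h2)

/-- `min` of two locally Lipschitz real functions is locally Lipschitz. [folklore] -/
theorem _root_.LocallyLipschitzOn.min_real {α : Type*} [PseudoEMetricSpace α] {f g : α → ℝ}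
    {s : Set α} (hf : LocallyLipschitzOn s f) (hg : LocallyLipschitzOn s g) :
    LocallyLipschitzOn s fun x ↦ min (f x) (g x) := by
  intro x hx
  obtain ⟨Kf, t, ht, hKf⟩ := hf hx
  obtain ⟨Kg, t', ht', hKg⟩ := hg hx
  refine ⟨max Kf Kg, t ∩ t', inter_mem ht ht', ?_⟩
  have h1 : LipschitzWith Kf ((t ∩ t').restrict f) :=
    lipschitzOnWith_iff_restrict.1 (hKf.mono Set.inter_subset_left)
  have h2 : LipschitzWith Kg ((t ∩ t').restrict g) :=
    lipschitzOnWith_iff_restrict.1 (hKg.mono Set.inter_subset_right)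
  exact lipschitzOnWith_iff_restrict.2 (h1.min h2)

/-- A constant multiple of a locally Lipschitz real function is locally Lipschitz. [folklore] -/
theorem _root_.LocallyLipschitzOn.const_mul_real {α : Type*} [PseudoEMetricSpace α] {f : α → ℝ}
    {s : Set α} (hf : LocallyLipschitzOn s f) (c : ℝ) :
    LocallyLipschitzOn s fun x ↦ c * f x := by
  intro x hx
  obtain ⟨K, t, ht, hK⟩ := hf hx
  exact ⟨‖c‖₊ * K, t, ht, (lipschitzWith_smul c).comp_lipschitzOnWith hK⟩

variable (h : ContMDiffRiemannianMetric (𝓡 3) ∞ E3 (TangentSpace (𝓡 3) : X → Type _))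
  [T2Space X] [LocallyCompactSpace X]

/-- Sums of locally Lipschitz functions (Riemannian distance) are locally Lipschitz. [folklore] -/
theorem IsLocLipschitzOn.add {u v : X → ℝ} {Ω : Set X} (hu : IsLocLipschitzOn h u Ω)
    (hv : IsLocLipschitzOn h v Ω) : IsLocLipschitzOn h (fun x ↦ u x + v x) Ω := by
  letI : RiemannianBundle (fun x : X ↦ TangentSpace (𝓡 3) x) :=
    ⟨h.toContinuousRiemannianMetric.toRiemannianMetric⟩
  letI : PseudoEMetricSpace X := .ofRiemannianMetric (𝓡 3) X
  exact LocallyLipschitzOn.add hu hv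

/-- Differences of locally Lipschitz functions are locally Lipschitz. [folklore] -/
theorem IsLocLipschitzOn.sub {u v : X → ℝ} {Ω : Set X} (hu : IsLocLipschitzOn h u Ω)
    (hv : IsLocLipschitzOn h v Ω) : IsLocLipschitzOn h (fun x ↦ u x - v x) Ω := by
  letI : RiemannianBundle (fun x : X ↦ TangentSpace (𝓡 3) x) :=
    ⟨h.toContinuousRiemannianMetric.toRiemannianMetric⟩
  letI : PseudoEMetricSpace X := .ofRiemannianMetric (𝓡 3) X
  exact LocallyLipschitzOn.sub hu hv

/-- Negatives of locally Lipschitz functions are locally Lipschitz. [folklore] -/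
theorem IsLocLipschitzOn.neg {u : X → ℝ} {Ω : Set X} (hu : IsLocLipschitzOn h u Ω) :
    IsLocLipschitzOn h (fun x ↦ -u x) Ω := by
  letI : RiemannianBundle (fun x : X ↦ TangentSpace (𝓡 3) x) :=
    ⟨h.toContinuousRiemannianMetric.toRiemannianMetric⟩
  letI : PseudoEMetricSpace X := .ofRiemannianMetric (𝓡 3) X
  exact LocallyLipschitzOn.neg hu

/-- `u + c` is locally Lipschitz if `u` is (translation of the level-set function, used for
`u + δ`, `v - s` in the proof of Thm. 2.2). [folklore] -/
theorem IsLocLipschitzOn.add_const {u : X → ℝ} {Ω : Set X} (hu : IsLocLipschitzOn h u Ω)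
    (c : ℝ) : IsLocLipschitzOn h (fun x ↦ u x + c) Ω :=
  hu.add h (isLocLipschitzOn_const h c Ω)

/-- `c u` is locally Lipschitz if `u` is (used for `u / (1 - ε)` in the proof of Thm. 2.2 (i)).
[folklore] -/
theorem IsLocLipschitzOn.const_mul {u : X → ℝ} {Ω : Set X} (hu : IsLocLipschitzOn h u Ω)
    (c : ℝ) : IsLocLipschitzOn h (fun x ↦ c * u x) Ω := by
  letI : RiemannianBundle (fun x : X ↦ TangentSpace (𝓡 3) x) :=
    ⟨h.toContinuousRiemannianMetric.toRiemannianMetric⟩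
  letI : PseudoEMetricSpace X := .ofRiemannianMetric (𝓡 3) X
  exact LocallyLipschitzOn.const_mul_real hu c

/-- `max(u, v)` is locally Lipschitz if `u, v` are (the competitors `max(u, v) = u + (v - u)₊` of
Huisken–Ilmanen's proof of Thm. 2.2 (i)). [folklore] -/
theorem IsLocLipschitzOn.sup {u v : X → ℝ} {Ω : Set X} (hu : IsLocLipschitzOn h u Ω)
    (hv : IsLocLipschitzOn h v Ω) : IsLocLipschitzOn h (fun x ↦ max (u x) (v x)) Ω := by
  letI : RiemannianBundle (fun x : X ↦ TangentSpace (𝓡 3) x) :=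
    ⟨h.toContinuousRiemannianMetric.toRiemannianMetric⟩
  letI : PseudoEMetricSpace X := .ofRiemannianMetric (𝓡 3) X
  exact LocallyLipschitzOn.max_real hu hv

/-- `min(u, v)` is locally Lipschitz if `u, v` are (the competitors `min(u, v) = v - (v - u)₊` and
`min(u, t)` of (1.18) and Thm. 2.2). [folklore] -/
theorem IsLocLipschitzOn.inf {u v : X → ℝ} {Ω : Set X} (hu : IsLocLipschitzOn h u Ω)
    (hv : IsLocLipschitzOn h v Ω) : IsLocLipschitzOn h (fun x ↦ min (u x) (v x)) Ω := by
  letI : RiemannianBundle (fun x : X ↦ TangentSpace (𝓡 3) x) :=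
    ⟨h.toContinuousRiemannianMetric.toRiemannianMetric⟩
  letI : PseudoEMetricSpace X := .ofRiemannianMetric (𝓡 3) X
  exact LocallyLipschitzOn.min_real hu hv

/-- The positive part `u₊ = max(u, 0)` is locally Lipschitz if `u` is. [folklore] -/
theorem IsLocLipschitzOn.posPart {u : X → ℝ} {Ω : Set X} (hu : IsLocLipschitzOn h u Ω) :
    IsLocLipschitzOn h (fun x ↦ max (u x) 0) Ω :=
  hu.sup h (isLocLipschitzOn_const h 0 Ω)

end LipschitzAlgebra

/-! ### Pointwise identities for the slope -/

section Pointwise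

variable (h : ContMDiffRiemannianMetric (𝓡 3) ∞ E3 (TangentSpace (𝓡 3) : X → Type _))

/-- The slope depends only on the differential. [folklore] -/
theorem gradNorm_eq_of_mfderiv_eq {u v : X → ℝ} {x : X}
    (huv : mfderiv (𝓡 3) 𝓘(ℝ, ℝ) u x = mfderiv (𝓡 3) 𝓘(ℝ, ℝ) v x) :
    gradNorm h u x = gradNorm h v x := by
  unfold gradNorm
  rw [huv]

/-- Chart criterion for equality of slopes: if the chart representatives of `u` and `v` (chart at
`x`) have the same Fréchet derivative at `φ x`, then `|∇u|(x) = |∇v|(x)` (`gradNorm_sq_eq_sum_chart`).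
[folklore] -/
theorem gradNorm_eq_of_fderiv_chart_eq {u v : X → ℝ} {x : X}
    (huv : fderiv ℝ (u ∘ (extChartAt (𝓡 3) x).symm) (extChartAt (𝓡 3) x x) =
      fderiv ℝ (v ∘ (extChartAt (𝓡 3) x).symm) (extChartAt (𝓡 3) x x)) :
    gradNorm h u x = gradNorm h v x := by
  classical
  have hx := mem_chart_source E3 x
  have h1 := gradNorm_sq_eq_sum_chart h (EuclideanSpace.basisFun (Fin 3) ℝ).toBasis (u := u) hx
  have h2 := gradNorm_sq_eq_sum_chart h (EuclideanSpace.basisFun (Fin 3) ℝ).toBasis (u := v) hx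
  rw [huv, ← h2] at h1
  exact (sq_eq_sq₀ (gradNorm_nonneg h u x) (gradNorm_nonneg h v x)).1 h1

/-- Chart criterion for scaling of slopes: if `D(u ∘ φ⁻¹)(φ x) = c D(v ∘ φ⁻¹)(φ x)` then
`|∇u|(x) = |c| |∇v|(x)`. [folklore] -/
theorem gradNorm_eq_abs_mul_of_fderiv_chart_eq_smul {u v : X → ℝ} {x : X} (c : ℝ)
    (huv : fderiv ℝ (u ∘ (extChartAt (𝓡 3) x).symm) (extChartAt (𝓡 3) x x) =
      c • fderiv ℝ (v ∘ (extChartAt (𝓡 3) x).symm) (extChartAt (𝓡 3) x x)) :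
    gradNorm h u x = |c| * gradNorm h v x := by
  classical
  have hx := mem_chart_source E3 x
  have h1 := gradNorm_sq_eq_sum_chart h (EuclideanSpace.basisFun (Fin 3) ℝ).toBasis (u := u) hx
  have h2 := gradNorm_sq_eq_sum_chart h (EuclideanSpace.basisFun (Fin 3) ℝ).toBasis (u := v) hx
  have h3 : gradNorm h u x ^ 2 = (|c| * gradNorm h v x) ^ 2 := by
    rw [mul_pow, sq_abs, h2, h1, huv, Finset.mul_sum]
    refine Finset.sum_congr rfl fun l _ ↦ ?_
    rw [Finset.mul_sum]
    refine Finset.sum_congr rfl fun k _ ↦ ?_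
    simp only [FunLike.coe_smul, Pi.smul_apply, smul_eq_mul]
    ring
  exact (sq_eq_sq₀ (gradNorm_nonneg h u x) (mul_nonneg (abs_nonneg c) (gradNorm_nonneg h v x))).1 h3

/-- **Translation invariance of the slope**: `|∇(u + c)| = |∇u|` everywhere (the Fréchet
derivative of `û + c` is that of `û`, with or without differentiability). [folklore] -/
theorem gradNorm_add_const (u : X → ℝ) (c : ℝ) (x : X) :
    gradNorm h (fun y ↦ u y + c) x = gradNorm h u x :=
  gradNorm_eq_of_fderiv_chart_eq h (by
    rw [show ((fun y ↦ u y + c) ∘ (extChartAt (𝓡 3) x).symm) =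
      fun z ↦ (u ∘ (extChartAt (𝓡 3) x).symm) z + c from rfl, fderiv_add_const])

/-- `|∇(u - c)| = |∇u|` everywhere. [folklore] -/
theorem gradNorm_sub_const (u : X → ℝ) (c : ℝ) (x : X) :
    gradNorm h (fun y ↦ u y - c) x = gradNorm h u x := by
  simpa only [sub_eq_add_neg] using gradNorm_add_const h u (-c) x

/-- **Scaling of the slope**: `|∇(c u)| = |c| |∇u|` everywhere (`D(c û) = c Dû` for field scalars,
with or without differentiability, Mathlib's `fderiv_const_smul_field`). [folklore] -/
theorem gradNorm_const_mul (u : X → ℝ) (c : ℝ) (x : X) :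
    gradNorm h (fun y ↦ c * u y) x = |c| * gradNorm h u x :=
  gradNorm_eq_abs_mul_of_fderiv_chart_eq_smul h c (by
    rw [show ((fun y ↦ c * u y) ∘ (extChartAt (𝓡 3) x).symm) =
      c • (u ∘ (extChartAt (𝓡 3) x).symm) from rfl, fderiv_const_smul_field]
    rfl)

/-- `|∇(-u)| = |∇u|` everywhere. [folklore] -/
theorem gradNorm_neg (u : X → ℝ) (x : X) : gradNorm h (fun y ↦ -u y) x = gradNorm h u x := by
  have := gradNorm_const_mul h u (-1) x
  simp only [neg_mul, one_mul, abs_neg, abs_one] at this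
  exact this

/-- `|∇(u - v)| = |∇(v - u)|` everywhere. [folklore] -/
theorem gradNorm_sub_comm (u v : X → ℝ) (x : X) :
    gradNorm h (fun y ↦ u y - v y) x = gradNorm h (fun y ↦ v y - u y) x := by
  rw [← gradNorm_neg h (fun y ↦ v y - u y) x]
  simp only [neg_sub]

/-- Where `u < v` (both continuous at the point), `|∇ max(u, v)| = |∇v|`. [folklore] -/
theorem gradNorm_sup_of_lt {u v : X → ℝ} {x : X} (hux : ContinuousAt u x) (hvx : ContinuousAt v x)
    (hlt : u x < v x) : gradNorm h (fun y ↦ max (u y) (v y)) x = gradNorm h v x :=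
  gradNorm_congr_of_eventuallyEq h
    ((hux.eventually_lt hvx hlt).mono fun _ hy ↦ max_eq_right hy.le)

/-- Where `v < u`, `|∇ max(u, v)| = |∇u|`. [folklore] -/
theorem gradNorm_sup_of_gt {u v : X → ℝ} {x : X} (hux : ContinuousAt u x) (hvx : ContinuousAt v x)
    (hgt : v x < u x) : gradNorm h (fun y ↦ max (u y) (v y)) x = gradNorm h u x :=
  gradNorm_congr_of_eventuallyEq h
    ((hvx.eventually_lt hux hgt).mono fun _ hy ↦ max_eq_left hy.le)

/-- Where `u < v`, `|∇ min(u, v)| = |∇u|`. [folklore] -/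
theorem gradNorm_inf_of_lt {u v : X → ℝ} {x : X} (hux : ContinuousAt u x) (hvx : ContinuousAt v x)
    (hlt : u x < v x) : gradNorm h (fun y ↦ min (u y) (v y)) x = gradNorm h u x :=
  gradNorm_congr_of_eventuallyEq h
    ((hux.eventually_lt hvx hlt).mono fun _ hy ↦ min_eq_left hy.le)

/-- Where `v < u`, `|∇ min(u, v)| = |∇v|`. [folklore] -/
theorem gradNorm_inf_of_gt {u v : X → ℝ} {x : X} (hux : ContinuousAt u x) (hvx : ContinuousAt v x)
    (hgt : v x < u x) : gradNorm h (fun y ↦ min (u y) (v y)) x = gradNorm h v x :=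
  gradNorm_congr_of_eventuallyEq h
    ((hvx.eventually_lt hux hgt).mono fun _ hy ↦ min_eq_right hy.le)

/-- Where `u > 0`, `|∇ u₊| = |∇u|`. [folklore] -/
theorem gradNorm_posPart_of_pos {u : X → ℝ} {x : X} (hux : ContinuousAt u x) (hpos : 0 < u x) :
    gradNorm h (fun y ↦ max (u y) 0) x = gradNorm h u x :=
  gradNorm_sup_of_gt h hux continuousAt_const hpos

/-- Where `u < 0`, `|∇ u₊| = 0`. [folklore] -/
theorem gradNorm_posPart_of_neg {u : X → ℝ} {x : X} (hux : ContinuousAt u x) (hneg : u x < 0) :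
    gradNorm h (fun y ↦ max (u y) 0) x = 0 :=
  (gradNorm_sup_of_lt h hux continuousAt_const hneg).trans (gradNorm_const h 0 x)

set_option backward.isDefEq.respectTransparency false in
/-- **Triangle inequality for the slope** at a point where both functions are differentiable:
`|∇(u + v)| ≤ |∇u| + |∇v|` (`|∇u|(x) = ‖♯du_x‖_x` and `♯` is linear). [folklore] -/
theorem gradNorm_add_le {u v : X → ℝ} {x : X} (hu : MDifferentiableAt (𝓡 3) 𝓘(ℝ, ℝ) u x)
    (hv : MDifferentiableAt (𝓡 3) 𝓘(ℝ, ℝ) v x) :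
    gradNorm h (fun y ↦ u y + v y) x ≤ gradNorm h u x + gradNorm h v x := by
  letI : RiemannianBundle (fun x : X ↦ TangentSpace (𝓡 3) x) :=
    ⟨h.toContinuousRiemannianMetric.toRiemannianMetric⟩
  -- `√(h⁻¹(α, α)) = ‖♯α‖`
  have key : ∀ α : Module.Dual ℝ (TangentSpace (𝓡 3) x),
      Real.sqrt ((ofRiemannian h).innerDual x α α) = ‖(ofRiemannian h).sharp x α‖ := by
    intro α
    rw [← Real.sqrt_sq (norm_nonneg _), ← real_inner_self_eq_norm_sq]
    congr 1
    change α ((ofRiemannian h).sharp x α) = h.inner x _ _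
    rw [← val_ofRiemannian, val_sharp_apply]
  have hadd : (mfderiv (𝓡 3) 𝓘(ℝ, ℝ) (fun y ↦ u y + v y) x : TangentSpace (𝓡 3) x →L[ℝ] ℝ) =
      (by exact mfderiv (𝓡 3) 𝓘(ℝ, ℝ) u x) + (by exact mfderiv (𝓡 3) 𝓘(ℝ, ℝ) v x) :=
    mfderiv_add hu hv
  unfold gradNorm
  rw [key, key, key, hadd, ContinuousLinearMap.toLinearMap_add, map_add]
  exact norm_add_le _ _

end Pointwise

/-! ### A.e. identities for the slopes of `max`, `min` and positive parts -/

section AE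

variable (h : ContMDiffRiemannianMetric (𝓡 3) ∞ E3 (TangentSpace (𝓡 3) : X → Type _))
  [T2Space X] [LocallyCompactSpace X] [MeasurableSpace X] [BorelSpace X]
  [SecondCountableTopology X]

/-- **Differentials agree a.e. on the coincidence set**: for `u, v` locally Lipschitz on the open
set `Ω`, `du_p = dv_p` for `μ_h`-a.e. `p ∈ Ω` with `u p = v p`
(`ae_mfderiv_eq_zero_of_eq_zero` for `u - v`, and Rademacher for `u`, `v`).
[cite: HuiskenIlmanenIMCF2001, §1 proof of Lemma 1.4 (ii)] -/
theorem IsLocLipschitzOn.ae_mfderiv_eq_of_eq {u v : X → ℝ} {Ω : Set X}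
    (hu : IsLocLipschitzOn h u Ω) (hv : IsLocLipschitzOn h v Ω) (hΩ : IsOpen Ω) :
    ∀ᵐ p ∂(riemannianMeasure h), p ∈ Ω → u p = v p →
      mfderiv (𝓡 3) 𝓘(ℝ, ℝ) u p = mfderiv (𝓡 3) 𝓘(ℝ, ℝ) v p := by
  filter_upwards [(hu.sub h hv).ae_mfderiv_eq_zero_of_eq_zero h hΩ, hu.ae_mdifferentiableAt h hΩ,
    hv.ae_mdifferentiableAt h hΩ] with p hp hup hvp hpΩ huv
  have h1 : mfderiv (𝓡 3) 𝓘(ℝ, ℝ) (fun x ↦ u x - v x) p = 0 := hp hpΩ (by simp [huv])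
  have h2 := (((hup hpΩ).hasMFDerivAt).sub ((hvp hpΩ).hasMFDerivAt)).mfderiv
  rw [show (u - v) = fun x ↦ u x - v x from rfl, h1] at h2
  exact sub_eq_zero.1 h2.symm

/-- **Slopes agree a.e. on the coincidence set**: for `u, v` locally Lipschitz on the open set
`Ω`, `|∇u| = |∇v|` at `μ_h`-a.e. point of `Ω ∩ {u = v}`. This is the device by which all energy
comparisons of Huisken–Ilmanen §2 localise to the set where a competitor differs from `u`.
[cite: HuiskenIlmanenIMCF2001, §1 proof of Lemma 1.4 (ii)] -/
theorem IsLocLipschitzOn.ae_gradNorm_eq_of_eq {u v : X → ℝ} {Ω : Set X}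
    (hu : IsLocLipschitzOn h u Ω) (hv : IsLocLipschitzOn h v Ω) (hΩ : IsOpen Ω) :
    ∀ᵐ p ∂(riemannianMeasure h), p ∈ Ω → u p = v p → gradNorm h u p = gradNorm h v p := by
  filter_upwards [hu.ae_mfderiv_eq_of_eq h hv hΩ] with p hp hpΩ huv
  exact gradNorm_eq_of_mfderiv_eq h (hp hpΩ huv)

/-- **`|∇u| = 0` a.e. on each level set `{u = t}`** of a locally Lipschitz `u`. Huisken–Ilmanen
2001, §1, proof of Lemma 1.4 (ii) ("the fact that `|∇u| = 0` a.e. on `{u = t}`").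
[cite: HuiskenIlmanenIMCF2001, §1 proof of Lemma 1.4 (ii)] -/
theorem IsLocLipschitzOn.ae_gradNorm_eq_zero_of_eq_const {u : X → ℝ} {Ω : Set X}
    (hu : IsLocLipschitzOn h u Ω) (hΩ : IsOpen Ω) (t : ℝ) :
    ∀ᵐ p ∂(riemannianMeasure h), p ∈ Ω → u p = t → gradNorm h u p = 0 := by
  filter_upwards [hu.ae_gradNorm_eq_of_eq h (isLocLipschitzOn_const h t Ω) hΩ] with p hp hpΩ hpt
  rw [hp hpΩ hpt, gradNorm_const]

/-- A.e. on `Ω ∩ {v ≤ u}`: `|∇ max(u, v)| = |∇u|`. [folklore] -/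
theorem IsLocLipschitzOn.ae_gradNorm_sup_of_le {u v : X → ℝ} {Ω : Set X}
    (hu : IsLocLipschitzOn h u Ω) (hv : IsLocLipschitzOn h v Ω) (hΩ : IsOpen Ω) :
    ∀ᵐ p ∂(riemannianMeasure h), p ∈ Ω → v p ≤ u p →
      gradNorm h (fun x ↦ max (u x) (v x)) p = gradNorm h u p := by
  filter_upwards [(hu.sup h hv).ae_gradNorm_eq_of_eq h hu hΩ] with p hp hpΩ hle
  exact hp hpΩ (max_eq_left hle)

/-- A.e. on `Ω ∩ {u ≤ v}`: `|∇ max(u, v)| = |∇v|`. [folklore] -/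
theorem IsLocLipschitzOn.ae_gradNorm_sup_of_ge {u v : X → ℝ} {Ω : Set X}
    (hu : IsLocLipschitzOn h u Ω) (hv : IsLocLipschitzOn h v Ω) (hΩ : IsOpen Ω) :
    ∀ᵐ p ∂(riemannianMeasure h), p ∈ Ω → u p ≤ v p →
      gradNorm h (fun x ↦ max (u x) (v x)) p = gradNorm h v p := by
  filter_upwards [(hu.sup h hv).ae_gradNorm_eq_of_eq h hv hΩ] with p hp hpΩ hle
  exact hp hpΩ (max_eq_right hle)

/-- A.e. on `Ω ∩ {u ≤ v}`: `|∇ min(u, v)| = |∇u|`. [folklore] -/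
theorem IsLocLipschitzOn.ae_gradNorm_inf_of_le {u v : X → ℝ} {Ω : Set X}
    (hu : IsLocLipschitzOn h u Ω) (hv : IsLocLipschitzOn h v Ω) (hΩ : IsOpen Ω) :
    ∀ᵐ p ∂(riemannianMeasure h), p ∈ Ω → u p ≤ v p →
      gradNorm h (fun x ↦ min (u x) (v x)) p = gradNorm h u p := by
  filter_upwards [(hu.inf h hv).ae_gradNorm_eq_of_eq h hu hΩ] with p hp hpΩ hle
  exact hp hpΩ (min_eq_left hle)

/-- A.e. on `Ω ∩ {v ≤ u}`: `|∇ min(u, v)| = |∇v|`. [folklore] -/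
theorem IsLocLipschitzOn.ae_gradNorm_inf_of_ge {u v : X → ℝ} {Ω : Set X}
    (hu : IsLocLipschitzOn h u Ω) (hv : IsLocLipschitzOn h v Ω) (hΩ : IsOpen Ω) :
    ∀ᵐ p ∂(riemannianMeasure h), p ∈ Ω → v p ≤ u p →
      gradNorm h (fun x ↦ min (u x) (v x)) p = gradNorm h v p := by
  filter_upwards [(hu.inf h hv).ae_gradNorm_eq_of_eq h hv hΩ] with p hp hpΩ hle
  exact hp hpΩ (min_eq_right hle)

/-- A.e. on `Ω ∩ {0 ≤ u}`: `|∇ u₊| = |∇u|`. [folklore] -/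
theorem IsLocLipschitzOn.ae_gradNorm_posPart_of_nonneg {u : X → ℝ} {Ω : Set X}
    (hu : IsLocLipschitzOn h u Ω) (hΩ : IsOpen Ω) :
    ∀ᵐ p ∂(riemannianMeasure h), p ∈ Ω → 0 ≤ u p →
      gradNorm h (fun x ↦ max (u x) 0) p = gradNorm h u p :=
  hu.ae_gradNorm_sup_of_le h (isLocLipschitzOn_const h 0 Ω) hΩ

/-- A.e. on `Ω ∩ {u ≤ 0}`: `|∇ u₊| = 0`. [folklore] -/
theorem IsLocLipschitzOn.ae_gradNorm_posPart_of_nonpos {u : X → ℝ} {Ω : Set X}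
    (hu : IsLocLipschitzOn h u Ω) (hΩ : IsOpen Ω) :
    ∀ᵐ p ∂(riemannianMeasure h), p ∈ Ω → u p ≤ 0 → gradNorm h (fun x ↦ max (u x) 0) p = 0 := by
  filter_upwards [(hu.posPart h).ae_gradNorm_eq_zero_of_eq_const h hΩ 0] with p hp hpΩ hle
  exact hp hpΩ (max_eq_right hle)

/-- **`|∇ max(u,v)| + |∇ min(u,v)| = |∇u| + |∇v|` a.e.** on `Ω`, for `u, v` locally Lipschitz
on the open set `Ω`. This is the pointwise content of Huisken–Ilmanen's identity
`J_u(min(v, w)) + J_u(max(v, w)) = J_u(v) + J_u(w)` (§1, after (1.5)).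
[cite: HuiskenIlmanenIMCF2001, §1 identity after (1.5)] -/
theorem IsLocLipschitzOn.ae_gradNorm_sup_add_gradNorm_inf {u v : X → ℝ} {Ω : Set X}
    (hu : IsLocLipschitzOn h u Ω) (hv : IsLocLipschitzOn h v Ω) (hΩ : IsOpen Ω) :
    ∀ᵐ p ∂(riemannianMeasure h), p ∈ Ω →
      gradNorm h (fun x ↦ max (u x) (v x)) p + gradNorm h (fun x ↦ min (u x) (v x)) p =
        gradNorm h u p + gradNorm h v p := by
  filter_upwards [hu.ae_gradNorm_sup_of_le h hv hΩ, hu.ae_gradNorm_inf_of_ge h hv hΩ]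
    with p h1 h2 hpΩ
  have huc : ContinuousAt u p := (hu.continuousOn h).continuousAt (hΩ.mem_nhds hpΩ)
  have hvc : ContinuousAt v p := (hv.continuousOn h).continuousAt (hΩ.mem_nhds hpΩ)
  rcases lt_or_ge (u p) (v p) with hlt | hle
  · rw [gradNorm_sup_of_lt h huc hvc hlt, gradNorm_inf_of_lt h huc hvc hlt, add_comm]
  · rw [h1 hpΩ hle, h2 hpΩ hle]

end AE

end Literature.Geometry.Lorentzian

end
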